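/-
Copyright: the b2b-balaban T⁴-continuum CRUX team, row NE7b OWNER lineage `t4-ne7b-p1` (gen 141). Project licence.
-/
import Summits.QuantumFields.BalabanUV.T4Continuum.Spine.NE7b.SupThirdKernelEntryLetters
import Summits.QuantumFields.BalabanUV.T4Continuum.Spine.NE7b.SupWhitenedHessianGradientCovariance
import Summits.QuantumFields.BalabanUV.T4Continuum.Spine.NE7b.SupWhitenedGradientHessianCovariance

/-!
# THE OUTPUT'S THIRD-ORDER LETTERS IN THE INPUT FORMAT (SCOPING (d13)(1), sixth file): (480)'s three fixed-slot sums INSTANTIATED at the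
# whitened vectors `g^{xy}_w = Σ_u|A_{uw}|K3_{xyu}`, `b^v_w = Σ_u|A_{uw}|Hk_{vu}` and `c = 1 − lamA`.  With the output majorant
# `K3⁺_{xyv} := M_{vxy}` ((479)'s `M`, the slots of `T` being `(v,x,y)`), the input format's three letters of `K3⁺` are
#   `k3c⁺ = Σ_yΣ_z K3⁺_{yzv} ≤ k3c + (2·αr·k3r·αc·hc + hr·αr·αc·k3c)·dr·dc∕(1−lamA) + C_T·S²`                    (slot 1 of `M`),
#   `k3r⁺ = Σ_yΣ_v K3⁺_{xyv} ≤ k3r + (hr·αr·αc·k3c + αr·k3m·αc·hc + αr·k3r·αc·hc)·dr·dc∕(1−lamA) + C_T·S²`        (slot 2),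
#   `k3m⁺ = Σ_xΣ_v K3⁺_{xyv} ≤ k3m + (2·αr·k3m·αc·hc + hr·αr·αc·k3c)·dr·dc∕(1−lamA) + C_T·S²`                    (slot 3),
# `C_T = 4√(m₄K)` — the input's three third-order letters `k3r, k3c, k3m`, the Hessian majorant's `hr, hc`, the factor's `αr, αc, lamA`, the
# plain letters `dr, dc` of `D` and the site letter `S` reproduce themselves with explicit constants (row NE7b, node U5c; (480), (469)
# `hessian_obs_mass_le`, (473) `hessian_family_colsum_le`, (456) `whitened_obs_rowsum_le`∕`whitened_obs_colsum_le`∕`whitened_obs_nonneg` BY NAME;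
# [folklore] finite sums)

Cell `pub-balaban`, sub-cell `t4`, spine estimate NE7b (`T4WeightBudget.RelWeightBound`; the cell's OWN estimate — NOT PRINTED in
[Bałaban 1983–89], NOT PROVED).  Crux-route work under `Spine/NE7b/` by the row OWNER (`t4-ne7b-p1` gen 141, file (482)) under FREEZE
(0)'s crux-prover clause; NOTHING of Bałaban's is named as a Lean object, valued or asserted; no `T4Continuum/Support` leaf typed; no
`def`, no notation (`K3⁺` WRITTEN OUT); zero `sorry`.  Imports (BY NAME): the OWNER's (480) `…SupThirdKernelEntryLetters`
(`entry_majorant_slot_one∕two∕three`), (469) `…SupWhitenedHessianGradientCovariance` (`hessian_obs_mass_le`), (473)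
`…SupWhitenedGradientHessianCovariance` (`hessian_family_colsum_le`); through them (456).

WHAT IS PROVED ([folklore]): §1 the masses `hessian_obs_mass_second` (`Σ_xΣ_wg^{xy}_w ≤ αr·k3m`), `hessian_obs_colsum` (`Σ_{y,z}g^{yz}_w ≤ αc·k3c`);
§2 THE ENDS **`output_k3c`**, **`output_k3r`**, **`output_k3m`**; §3 toy.

HONEST (what this is NOT).  Finite sums; the entry format, the row letter of `|T|` itself and the operator letter are the next file; `D`,
its letters and the weights are hypotheses; scalar skeleton ((A3), NC-NE7b-α UNRULED); nothing of Bałaban's asserted.  BY-NAME EFFECT ON THE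
WALL: NONE.  NE7b NOT PRINTED ∕ NOT PROVED; spine PROVED 0∕9; rung (B)+1 — the programme's measures remain FINITE-torus statements; NOT the
mass gap, NOT Clay.  HONEST DEPENDENCY: continuum YM on T⁴ ⇐ BetaPertH ∧ nine spine estimates (0∕9 proved); BetaPertH ⇐ (D1) ∧ (D4) ∧
CAP+tail; G-an2-4 gates asym, D1 and NE2∕3∕4.
-/

set_option autoImplicit false

noncomputable section

namespace Summit.QuantumFields.BalabanUV.T4Continuum.NE7b.SupKernelClassThirdLetters

open Real Finset
open scoped BigOperators
open SupThirdKernelEntryLetters (entry_majorant_slot_one entry_majorant_slot_two entry_majorant_slot_three)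
open SupWhitenedHessianGradientCovariance (hessian_obs_mass_le)
open SupWhitenedGradientHessianCovariance (hessian_family_colsum_le)
open SupWhitenedFirstOrderLetters (whitened_obs_nonneg whitened_obs_rowsum_le whitened_obs_colsum_le)

variable {ι κ : Type} [Fintype ι] [Fintype κ]

variable {Hk : ι → ι → ℝ} {K3 : ι → ι → ι → ℝ} {A : Matrix ι κ ℝ} {D : κ → κ → ℝ} {ρ : ι → ι → ℝ}
  {γop κ₂ lam lamA αr αc hr hc k3r k3c k3m dr dc dθ dθ' αθ βθ S : ℝ}

/-! ## §1. Two more masses of the Hessian-entry observables' vectors -/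

/-- **The second-index mass**: `Σ_xΣ_wΣ_u|A_{uw}|K3_{xyu} ≤ αr·k3m` for the letter `Σ_xΣ_uK3_{xyu} ≤ k3m`. [folklore] -/
theorem hessian_obs_mass_second (hK30 : ∀ x y u, 0 ≤ K3 x y u) (hαr : ∀ u, ∑ w, |A u w| ≤ αr) (hk3m : ∀ y, ∑ x, ∑ u, K3 x y u ≤ k3m)
    (y : ι) : ∑ x, ∑ w, ∑ u, |A u w| * K3 x y u ≤ αr * k3m := by
  rcases isEmpty_or_nonempty ι with hι | ⟨⟨u₀⟩⟩
  · exact (hι.false y).elim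
  have hαr0 : 0 ≤ αr := (Finset.sum_nonneg fun w _ => abs_nonneg (A u₀ w)).trans (hαr u₀)
  calc ∑ x, ∑ w, ∑ u, |A u w| * K3 x y u = ∑ x, ∑ u, K3 x y u * ∑ w, |A u w| := by
        refine Finset.sum_congr rfl fun x _ => ?_
        rw [Finset.sum_comm]
        refine Finset.sum_congr rfl fun u _ => ?_
        rw [Finset.mul_sum]
        exact Finset.sum_congr rfl fun w _ => by ring
    _ ≤ ∑ x, ∑ u, K3 x y u * αr := Finset.sum_le_sum fun x _ => Finset.sum_le_sum fun u _ => mul_le_mul_of_nonneg_left (hαr u) (hK30 x y u)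
    _ = αr * ∑ x, ∑ u, K3 x y u := by
        rw [Finset.mul_sum]
        refine Finset.sum_congr rfl fun x _ => ?_
        rw [Finset.mul_sum]
        exact Finset.sum_congr rfl fun u _ => by ring
    _ ≤ αr * k3m := mul_le_mul_of_nonneg_left (hk3m y) hαr0

omit [Fintype κ] in
/-- **The column mass over pairs** ((473) unfolded): `Σ_yΣ_zΣ_u|A_{uw}|K3_{yzu} ≤ αc·k3c`. [folklore] -/
theorem hessian_obs_colsum [Nonempty ι] (hK30 : ∀ x y u, 0 ≤ K3 x y u) (hαc : ∀ w, ∑ u, |A u w| ≤ αc) (hk3c : ∀ u, ∑ y, ∑ z, K3 y z u ≤ k3c)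
    (w : κ) : ∑ y, ∑ z, ∑ u, |A u w| * K3 y z u ≤ αc * k3c := by
  have h := hessian_family_colsum_le hK30 hαc hk3c w
  rw [Fintype.sum_prod_type] at h
  exact h

/-! ## §2. THE ENDS: the three letters of `K3⁺_{xyv} = M_{vxy}` -/

/-- **`k3c⁺`** (`v` fixed; slot 1 of `M`): `Σ_yΣ_z K3⁺_{yzv} ≤ k3c + (2·αr·k3r·αc·hc + hr·αr·αc·k3c)·dr·dc∕(1−lamA) + C_T·S²`. [folklore] -/
theorem output_k3c [Nonempty κ] (hK30 : ∀ x y u, 0 ≤ K3 x y u) (hHk0 : ∀ v u, 0 ≤ Hk v u)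
    (hαr : ∀ u, ∑ w, |A u w| ≤ αr) (hαc : ∀ w, ∑ u, |A u w| ≤ αc) (hhr : ∀ v, ∑ u, Hk v u ≤ hr) (hhc : ∀ u, ∑ v, Hk v u ≤ hc)
    (hk3r : ∀ x, ∑ y, ∑ u, K3 x y u ≤ k3r) (hk3c : ∀ u, ∑ y, ∑ z, K3 y z u ≤ k3c)
    (hlamA1 : lamA < 1) (hD : ∀ x y, 0 ≤ D x y) (hDr : ∀ z, ∑ w, D z w ≤ dr) (hDc : ∀ w, ∑ z, D z w ≤ dc)
    (hCT : 0 ≤ 4 * Real.sqrt (5 * (κ₂ ^ 4 * γop ^ 2) / (1 - lam * γop) ^ 2 * (αθ * dθ * (βθ * dθ') / (1 - lamA))))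
    (hρ1 : ∀ x y, 1 ≤ ρ x y) (hS : ∀ x, ∑ y, 1 / ρ x y ≤ S) (v : ι) :
    ∑ y, ∑ z, (K3 y z v + ∑ w, (∑ z', D z' w * ∑ u, |A u z'| * K3 v z u) * (∑ z', D z' w * ∑ u, |A u z'| * Hk y u) / (1 - lamA) + ∑ w, (∑ z', D z' w
        * ∑ u, |A u z'| * K3 v y u) * (∑ z', D z' w * ∑ u, |A u z'| * Hk z u) / (1 - lamA) + ∑ w, (∑ z', D z' w * ∑ u, |A u z'| * Hk v u) * (∑ z', D
        z' w * ∑ u, |A u z'| * K3 y z u) / (1 - lamA) + 4 * Real.sqrt (5 * (κ₂ ^ 4 * γop ^ 2) / (1 - lam * γop) ^ 2 * (αθ * dθ * (βθ * dθ') / (1 -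
        lamA))) / (ρ v y * ρ v z)) ≤
      k3c + (2 * (αr * k3r * (αc * hc)) + hr * αr * (αc * k3c)) * dr * dc / (1 - lamA) + 4 * Real.sqrt (5 * (κ₂ ^ 4 * γop ^ 2) / (1 - lam * γop) ^ 2
          * (αθ * dθ * (βθ * dθ') / (1 - lamA))) * S ^ 2 := by
  haveI : Nonempty ι := ⟨v⟩
  have hc : 0 < 1 - lamA := by linarith
  exact entry_majorant_slot_one (g := fun p q w' => ∑ u, |A u w'| * K3 p q u) (b := fun r w' => ∑ u, |A u w'| * Hk r u) hD hDr hDc hc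
    (fun p q w' => Finset.sum_nonneg fun u _ => mul_nonneg (abs_nonneg _) (hK30 p q u)) (fun r w' => whitened_obs_nonneg hHk0 A r w')
    (fun x => hessian_obs_mass_le hK30 hαr hk3r x) (fun w' => hessian_obs_colsum hK30 hαc hk3c w') (fun r => whitened_obs_rowsum_le hHk0 hαr hhr r)
    (fun w' => whitened_obs_colsum_le hHk0 hαc hhc w') hk3c hCT hρ1 hS v

/-- **`k3r⁺`** (`x` fixed; slot 2 of `M`): `Σ_yΣ_v K3⁺_{xyv} ≤ k3r + (hr·αr·αc·k3c + αr·k3m·αc·hc + αr·k3r·αc·hc)·dr·dc∕(1−lamA) + C_T·S²`.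
[folklore] -/
theorem output_k3r [Nonempty κ] (hK30 : ∀ x y u, 0 ≤ K3 x y u) (hHk0 : ∀ v u, 0 ≤ Hk v u)
    (hαr : ∀ u, ∑ w, |A u w| ≤ αr) (hαc : ∀ w, ∑ u, |A u w| ≤ αc) (hhr : ∀ v, ∑ u, Hk v u ≤ hr) (hhc : ∀ u, ∑ v, Hk v u ≤ hc)
    (hk3r : ∀ x, ∑ y, ∑ u, K3 x y u ≤ k3r) (hk3c : ∀ u, ∑ y, ∑ z, K3 y z u ≤ k3c) (hk3m : ∀ y, ∑ x, ∑ u, K3 x y u ≤ k3m)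
    (hlamA1 : lamA < 1) (hD : ∀ x y, 0 ≤ D x y) (hDr : ∀ z, ∑ w, D z w ≤ dr) (hDc : ∀ w, ∑ z, D z w ≤ dc)
    (hCT : 0 ≤ 4 * Real.sqrt (5 * (κ₂ ^ 4 * γop ^ 2) / (1 - lam * γop) ^ 2 * (αθ * dθ * (βθ * dθ') / (1 - lamA))))
    (hρ1 : ∀ x y, 1 ≤ ρ x y) (hρsymm : ∀ x y, ρ x y = ρ y x) (hS : ∀ x, ∑ y, 1 / ρ x y ≤ S) (x : ι) :
    ∑ y, ∑ v, (K3 x y v + ∑ w, (∑ z', D z' w * ∑ u, |A u z'| * K3 v y u) * (∑ z', D z' w * ∑ u, |A u z'| * Hk x u) / (1 - lamA) + ∑ w, (∑ z', D z' w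
        * ∑ u, |A u z'| * K3 v x u) * (∑ z', D z' w * ∑ u, |A u z'| * Hk y u) / (1 - lamA) + ∑ w, (∑ z', D z' w * ∑ u, |A u z'| * Hk v u) * (∑ z', D
        z' w * ∑ u, |A u z'| * K3 x y u) / (1 - lamA) + 4 * Real.sqrt (5 * (κ₂ ^ 4 * γop ^ 2) / (1 - lam * γop) ^ 2 * (αθ * dθ * (βθ * dθ') / (1 -
        lamA))) / (ρ v x * ρ v y)) ≤
      k3r + (hr * αr * (αc * k3c) + αr * k3m * (αc * hc) + αr * k3r * (αc * hc)) * dr * dc / (1 - lamA) + 4 * Real.sqrt (5 * (κ₂ ^ 4 * γop ^ 2) / (1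
          - lam * γop) ^ 2 * (αθ * dθ * (βθ * dθ') / (1 - lamA))) * S ^ 2 := by
  haveI : Nonempty ι := ⟨x⟩
  have hc : 0 < 1 - lamA := by linarith
  rw [Finset.sum_comm]
  exact entry_majorant_slot_two (g := fun p q w' => ∑ u, |A u w'| * K3 p q u) (b := fun r w' => ∑ u, |A u w'| * Hk r u) hD hDr hDc hc
    (fun p q w' => Finset.sum_nonneg fun u _ => mul_nonneg (abs_nonneg _) (hK30 p q u)) (fun r w' => whitened_obs_nonneg hHk0 A r w')
    (fun x => hessian_obs_mass_le hK30 hαr hk3r x) (fun y => hessian_obs_mass_second hK30 hαr hk3m y) (fun w' => hessian_obs_colsum hK30 hαc hk3c w')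
    (fun r => whitened_obs_rowsum_le hHk0 hαr hhr r) (fun w' => whitened_obs_colsum_le hHk0 hαc hhc w') hk3r hCT hρ1 hρsymm hS x

/-- **`k3m⁺`** (`y` fixed; slot 3 of `M`): `Σ_xΣ_v K3⁺_{xyv} ≤ k3m + (2·αr·k3m·αc·hc + hr·αr·αc·k3c)·dr·dc∕(1−lamA) + C_T·S²`. [folklore] -/
theorem output_k3m [Nonempty κ] (hK30 : ∀ x y u, 0 ≤ K3 x y u) (hHk0 : ∀ v u, 0 ≤ Hk v u)
    (hαr : ∀ u, ∑ w, |A u w| ≤ αr) (hαc : ∀ w, ∑ u, |A u w| ≤ αc) (hhr : ∀ v, ∑ u, Hk v u ≤ hr) (hhc : ∀ u, ∑ v, Hk v u ≤ hc)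
    (hk3c : ∀ u, ∑ y, ∑ z, K3 y z u ≤ k3c) (hk3m : ∀ y, ∑ x, ∑ u, K3 x y u ≤ k3m)
    (hlamA1 : lamA < 1) (hD : ∀ x y, 0 ≤ D x y) (hDr : ∀ z, ∑ w, D z w ≤ dr) (hDc : ∀ w, ∑ z, D z w ≤ dc)
    (hCT : 0 ≤ 4 * Real.sqrt (5 * (κ₂ ^ 4 * γop ^ 2) / (1 - lam * γop) ^ 2 * (αθ * dθ * (βθ * dθ') / (1 - lamA))))
    (hρ1 : ∀ x y, 1 ≤ ρ x y) (hρsymm : ∀ x y, ρ x y = ρ y x) (hS : ∀ x, ∑ y, 1 / ρ x y ≤ S) (y : ι) :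
    ∑ x, ∑ v, (K3 x y v + ∑ w, (∑ z', D z' w * ∑ u, |A u z'| * K3 v y u) * (∑ z', D z' w * ∑ u, |A u z'| * Hk x u) / (1 - lamA) + ∑ w, (∑ z', D z' w
        * ∑ u, |A u z'| * K3 v x u) * (∑ z', D z' w * ∑ u, |A u z'| * Hk y u) / (1 - lamA) + ∑ w, (∑ z', D z' w * ∑ u, |A u z'| * Hk v u) * (∑ z', D
        z' w * ∑ u, |A u z'| * K3 x y u) / (1 - lamA) + 4 * Real.sqrt (5 * (κ₂ ^ 4 * γop ^ 2) / (1 - lam * γop) ^ 2 * (αθ * dθ * (βθ * dθ') / (1 -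
        lamA))) / (ρ v x * ρ v y)) ≤
      k3m + (2 * (αr * k3m * (αc * hc)) + hr * αr * (αc * k3c)) * dr * dc / (1 - lamA) + 4 * Real.sqrt (5 * (κ₂ ^ 4 * γop ^ 2) / (1 - lam * γop) ^ 2
          * (αθ * dθ * (βθ * dθ') / (1 - lamA))) * S ^ 2 := by
  haveI : Nonempty ι := ⟨y⟩
  have hc : 0 < 1 - lamA := by linarith
  rw [Finset.sum_comm]
  exact entry_majorant_slot_three (g := fun p q w' => ∑ u, |A u w'| * K3 p q u) (b := fun r w' => ∑ u, |A u w'| * Hk r u) hD hDr hDc hc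
    (fun p q w' => Finset.sum_nonneg fun u _ => mul_nonneg (abs_nonneg _) (hK30 p q u)) (fun r w' => whitened_obs_nonneg hHk0 A r w')
    (fun y => hessian_obs_mass_second hK30 hαr hk3m y) (fun w' => hessian_obs_colsum hK30 hαc hk3c w')
    (fun r => whitened_obs_rowsum_le hHk0 hαr hhr r) (fun w' => whitened_obs_colsum_le hHk0 hαc hhc w') hk3m hCT hρ1 hρsymm hS y

/-! ## §3. Toy -/

/-- Toy (§1's mass in numbers): `Σ_{x∈{0}}Σ_{w∈{0}}Σ_{u∈{0}} 1·1 ≤ 1·1`. -/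
example : ∑ _x : Fin 1, ∑ _w : Fin 1, ∑ _u : Fin 1, |(1 : ℝ)| * 1 ≤ 1 * 1 := by simp

end Summit.QuantumFields.BalabanUV.T4Continuum.NE7b.SupKernelClassThirdLetters

end
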